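import Literature.Geometry.Lorentzian.CoordScalarGradientEvolution
import Literature.Geometry.Lorentzian.CoordRicciNormEvolution
import Literature.Geometry.Lorentzian.CoordCurvaturePairing
import Literature.Geometry.Lorentzian.CoordBianchiProjection
import Literature.Geometry.Lorentzian.CoordFormCauchySchwarz
import Literature.Geometry.Lorentzian.CoordShrinkerRicciLaplacian
import Literature.Geometry.Lorentzian.CoordRicciEvolution
import Literature.Geometry.Lorentzian.CoordPairingDerivQuadratic
import Literature.Geometry.Lorentzian.CoordCurvatureNormEvolution
import HarnessLib

/-!
# Hamilton's function `F = |∇S|²/S + N|E|²` along the Ricci flow, in coordinates (dimension 4)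

Support file (everything PROVED; no definition, no named fact) for **Hamilton 1982, §11** (the
gradient estimate for the scalar curvature, Thm. 11.1 with Lemmas 11.5–11.9; Lemma 17.4) in
dimension `4` (Huisken 1985, §4), wanted by the crux `ChangGurskyYang` of route
`SmoothPoincare4/EntropyRung` (item stmt-SmoothPoincare4-10834, line `margerin-cone-hamilton-rails`,
stub `stub_gradientEstimates`). In the chart calculus of `MetricCoord`, along `∂G/∂t = −2 Ric(G)`:

* `IsMetricFamilyOn.derivWithin_hamiltonF_le` — at a positive definite point with `S > 0` near it
  and `|E|² ≤ Λ S²` at it (`E = Ric − (S/4)G`), the function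
  `F = |∇S|²/S + N (|Ric|² − S²/4)`, `N = 180(1 + Λ)`, satisfies
  `∂ₜF ≤ ΔF − |∇S|² + N (64 √|Rm|² + S) |E|²`.

Ingredients: `∂ₜ(|∇S|²/S)` (`derivWithin_gradSqAt_div_scalAt_le`), `∂ₜ|Ric|²`
(`hasDerivWithinAt_normSqAt_ricAt_ricciFlow`), `∂ₜS` (`hasDerivWithinAt_scalAt_ricciFlow`), the
traceless decomposition of the reaction term (`reaction_traceless_decomposition`), the bound
`|B(E,E)| ≤ 16√|Rm|²|E|²` (`abs_curvPair_le`), `|∇Ric|² ≥ (5/18)|∇S|²`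
(`mul_gradSqAt_scalAt_le_covNormSq_ricAt`, Huisken's Lemma 4.3) and Cauchy–Schwarz for the cross
term `∂_{♯dS}|Ric|² = 2⟨∇_{♯dS}Ric, E⟩ + (S/2)|∇S|²`.

## References

* R. S. Hamilton, *Three-manifolds with positive Ricci curvature*, J. Differential Geom. 17 (1982)
  255–306, §11, Lemmas 11.5–11.9, Thm. 11.1; §17, Lemma 17.4. [Hamilton1982]
* G. Huisken, *Ricci deformation of the metric on a Riemannian manifold*, J. Differential Geom. 21
  (1985) 47–62, §4, Lemmas 4.2–4.3, Thm. 4.1. [Huisken1985]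
-/

noncomputable section

set_option maxSynthPendingDepth 3

open Set Filter ContinuousLinearMap Module
open scoped Topology ContDiff

namespace Literature.Geometry.Lorentzian

namespace MetricCoord

variable {E : Type*} [NormedAddCommGroup E] [NormedSpace ℝ E] [FiniteDimensional ℝ E]
  [CompleteSpace E]

namespace IsMetricFamilyOn

/-! ### Hamilton's function `F` -/

section RicciFlow

variable {G : ℝ → E → E →L[ℝ] E →L[ℝ] ℝ} {S : Set ℝ} {V : Set E} {x : E} {t : ℝ}
  (hG : IsMetricFamilyOn G S V)
  (hfl : ∀ s ∈ S, ∀ y ∈ V, tDeriv G S s y = (-2 : ℝ) • ricAt (G s) y)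
include hG hfl

/-- **`∂ₜ(S²/4) = Δ(S²/4) − |∇S|²/2 + S|Ric|²`** under the coordinate Ricci flow (from
`∂ₜS = ΔS + 2|Ric|²` and `Δ(S²) = 2SΔS + 2|∇S|²`). [cite: Hamilton1982, §11, Lemma 11.5] -/
theorem hasDerivWithinAt_scalAt_sq_div_four_ricciFlow (hx : x ∈ V) (ht : t ∈ S) :
    HasDerivWithinAt (fun s ↦ scalAt (G s) x ^ 2 / 4)
      (lapAt (G t) (fun y ↦ scalAt (G t) y ^ 2 / 4) x - gradSqAt (G t) (scalAt (G t)) x / 2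
        + scalAt (G t) x * normSqAt (G t) x (ricAt (G t) x)) S t := by
  have hGt := hG.isMetricOn t ht
  have hV := hG.isOpen ht
  have hi := hGt.isInvertible x hx
  have hsym := hGt.symm x hx
  have hScont : ContDiffOn ℝ ∞ (scalAt (G t)) V := hGt.contDiffOn_scalAt
  have hS2 : ContDiffAt ℝ 2 (scalAt (G t)) x :=
    ((hScont.contDiffAt (hV.mem_nhds hx)).of_le (by norm_cast))
  have hSt := hG.hasDerivWithinAt_scalAt_ricciFlow hfl hx ht
  have hsq := (hSt.pow 2).div_const 4
  refine hsq.congr_deriv ?_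
  -- `Δ(S²/4) = (S ΔS + |∇S|²)/2`
  have hlap : lapAt (G t) (fun y ↦ scalAt (G t) y ^ 2 / 4) x =
      (scalAt (G t) x * lapAt (G t) (scalAt (G t)) x + gradSqAt (G t) (scalAt (G t)) x) / 2 := by
    have hmul := lapAt_mul (G t) hi hsym hS2 hS2
    have heq : (fun y ↦ scalAt (G t) y ^ 2 / 4) = fun y ↦ (1 / 4 : ℝ) * (scalAt (G t) y * scalAt (G t) y) := by
      funext y; ring
    rw [heq, lapAt_const_mul (G t) (hS2.mul hS2), hmul, ← gradSqAt_apply]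
    ring
  rw [hlap]
  simp only [Nat.cast_ofNat]
  ring

/-- **Hamilton's evolution inequality for `F = |∇S|²/S + N|E|²` (1982, Lemmas 11.5–11.9 with
`η = 0`, i.e. the inequality behind Thm. 11.1 and Lemma 17.4), dimension 4.** Along
`∂G/∂t = −2 Ric(G)` on `V × S`, at `t ∈ S` and a positive definite point `x ∈ V`, if `S(G t) > 0` on
`V` and `|E|²(x) ≤ Λ S(x)²` (`|E|² = |Ric|² − S²/4`), then for `N = 180(1 + Λ)` the function
`F_s(y) = |∇S|²/S + N(|Ric|² − S²/4)` satisfies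

  `∂ₜ F ≤ Δ F − |∇S|² + N (64 √|Rm|² + S) |E|²`

at `(t, x)` (derivative within `S`). Proof as printed: `∂ₜ(|∇S|²/S) ≤ Δ(·) + 4∂_{♯dS}|Ric|²/S`
(Lemma 11.4), `∂_{♯dS}|Ric|² = 2⟨∇_{♯dS}Ric, E⟩ + (S/2)|∇S|²` with
`|⟨∇_{♯dS}Ric, E⟩| ≤ |∇Ric| |∇S| |E| ≤ |∇Ric| |∇S| √Λ S` (Young: `≤ (N/10)|∇Ric|² + (160Λ/N)|∇S|²`
after the `8/S`), `∂ₜ|E|² = Δ|E|² − 2|∇Ric|² + |∇S|²/2 + 4B(E,E) + S|E|²` (Lemma 11.2 with the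
traceless decomposition), `|∇Ric|² ≥ (5/18)|∇S|²` (Huisken's Lemma 4.3 in dimension 4) and
`B(E,E) ≤ 16√|Rm|²|E|²`; the coefficient of `|∇S|²` is then `3 + 160Λ/N − N/36 ≤ −1`.
[cite: Hamilton1982, §11, Lemmas 11.5–11.9, Thm. 11.1] [cite: Huisken1985, §4, Thm. 4.1] -/
theorem derivWithin_hamiltonF_le (hx : x ∈ V) (ht : t ∈ S) (h4 : finrank ℝ E = 4)
    (hpos : ∀ v : E, v ≠ 0 → 0 < G t x v v) (hS : ∀ y ∈ V, 0 < scalAt (G t) y)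
    {Λ : ℝ} (hΛ0 : 0 ≤ Λ)
    (hΛ : normSqAt (G t) x (ricAt (G t) x) - scalAt (G t) x ^ 2 / 4 ≤ Λ * scalAt (G t) x ^ 2) :
    derivWithin (fun s ↦ gradSqAt (G s) (scalAt (G s)) x / scalAt (G s) x
        + 180 * (1 + Λ) * (normSqAt (G s) x (ricAt (G s) x) - scalAt (G s) x ^ 2 / 4)) S t
      ≤ lapAt (G t) (fun y ↦ gradSqAt (G t) (scalAt (G t)) y / scalAt (G t) y
            + 180 * (1 + Λ) * (normSqAt (G t) y (ricAt (G t) y) - scalAt (G t) y ^ 2 / 4)) x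
        - gradSqAt (G t) (scalAt (G t)) x
        + 180 * (1 + Λ) * (64 * Real.sqrt (rmNormSqAt (G t) x) + scalAt (G t) x)
            * (normSqAt (G t) x (ricAt (G t) x) - scalAt (G t) x ^ 2 / 4) := by
  classical
  have hGt := hG.isMetricOn t ht
  have hV := hG.isOpen ht
  have hi := hGt.isInvertible x hx
  have hsym := hGt.symm x hx
  have hU := hG.uniqueDiffOn t ht
  set b := Module.finBasis ℝ E with hb
  -- names for the pointwise quantities at `(t, x)`
  set Sx : ℝ := scalAt (G t) x with hSx
  set Vx : ℝ := gradSqAt (G t) (scalAt (G t)) x with hVx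
  set Rn : ℝ := normSqAt (G t) x (ricAt (G t) x) with hRn
  set N : ℝ := 180 * (1 + Λ) with hN
  set φ : E →L[ℝ] ℝ := fderiv ℝ (scalAt (G t)) x with hφ
  set w : E := sharpAt (G t) x φ with hw
  set A : ℝ := fderiv ℝ (fun y ↦ normSqAt (G t) y (ricAt (G t) y)) x w with hA
  set Ef : E →L[ℝ] E →L[ℝ] ℝ := ricAt (G t) x - (Sx / 4) • G t x with hEf
  set CovR : ℝ := ∑ k, ∑ l, ginv (G t) b x k l *
      pairAt (G t) x (cov₂At (G t) (ricAt (G t)) x (b k)) (cov₂At (G t) (ricAt (G t)) x (b l))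
    with hCovR
  set BR : ℝ := ∑ i, ∑ j, ginv (G t) b x i j * ∑ k, b.coord k (sharpAt (G t) x
      (((ricAt (G t) x).flip (b j)).comp
        (riemAt (G t) x (b i) (sharpAt (G t) x (ricAt (G t) x (b k)))))) with hBR
  set BE : ℝ := ∑ i, ∑ j, ginv (G t) b x i j * ∑ k, b.coord k (sharpAt (G t) x
      ((Ef.flip (b j)).comp (riemAt (G t) x (b i) (sharpAt (G t) x (Ef (b k)))))) with hBE
  have hSpos : 0 < Sx := hS x hx
  have hSne : Sx ≠ 0 := hSpos.ne'
  have hNpos : 0 < N := by rw [hN]; positivity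
  have hn4 : (finrank ℝ E : ℝ) = 4 := by exact_mod_cast h4
  -- symmetry facts
  have hRsym : ∀ y ∈ V, ∀ v v', ricAt (G t) y v v' = ricAt (G t) y v' v := fun y hy ↦ hGt.ricAt_comm hy
  have hEsym : ∀ v v', Ef v v' = Ef v' v := fun v v' ↦ by
    simp only [hEf, _root_.sub_apply, _root_.smul_apply, smul_eq_mul, hRsym x hx v v', hsym v v']
  -- `|E|² = |Ric|² − S²/4`
  have hEn : normSqAt (G t) x Ef = Rn - Sx ^ 2 / 4 := by
    rw [hEf, normSqAt_sub_smul_metric hi hsym (hRsym x hx) (Sx / 4), h4]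
    rw [show mtrAt (G t) x (ricAt (G t) x) = Sx from rfl]
    norm_num
    ring
  have hEn0 : 0 ≤ Rn - Sx ^ 2 / 4 := by
    rw [← hEn]; exact hGt.normSqAt_nonneg_of_symm hx hpos hEsym
  have hRn0 : 0 ≤ Rn := hGt.normSqAt_nonneg_of_symm hx hpos (hRsym x hx)
  -- regularity of the space functions
  have hScont : ContDiffOn ℝ ∞ (scalAt (G t)) V := hGt.contDiffOn_scalAt
  have hVcont : ContDiffOn ℝ ∞ (gradSqAt (G t) (scalAt (G t))) V := hGt.contDiffOn_gradSqAt hScont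
  have hucont : ContDiffOn ℝ ∞ (fun y ↦ gradSqAt (G t) (scalAt (G t)) y / scalAt (G t) y) V :=
    hVcont.div hScont fun y hy ↦ (hS y hy).ne'
  have hRcont : ContDiffOn ℝ ∞ (fun y ↦ normSqAt (G t) y (ricAt (G t) y)) V :=
    hGt.contDiffOn_normSqAt hGt.contDiffOn_ricAt
  have hEcont : ContDiffOn ℝ ∞ (fun y ↦ normSqAt (G t) y (ricAt (G t) y) - scalAt (G t) y ^ 2 / 4) V :=
    hRcont.sub ((hScont.pow 2).div_const 4)
  have two : (2 : ℕ∞ω) ≤ ∞ := WithTop.coe_le_coe.mpr le_top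
  have hu2 : ContDiffAt ℝ 2 (fun y ↦ gradSqAt (G t) (scalAt (G t)) y / scalAt (G t) y) x :=
    (hucont.contDiffAt (hV.mem_nhds hx)).of_le two
  have hE2 : ContDiffAt ℝ 2 (fun y ↦ normSqAt (G t) y (ricAt (G t) y) - scalAt (G t) y ^ 2 / 4) x :=
    (hEcont.contDiffAt (hV.mem_nhds hx)).of_le two
  have hR2 : ContDiffAt ℝ 2 (fun y ↦ normSqAt (G t) y (ricAt (G t) y)) x :=
    (hRcont.contDiffAt (hV.mem_nhds hx)).of_le two
  have hS2q : ContDiffAt ℝ 2 (fun y ↦ scalAt (G t) y ^ 2 / 4) x :=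
    (((hScont.pow 2).div_const 4).contDiffAt (hV.mem_nhds hx)).of_le two
  -- (1) time derivatives
  have hVt := hG.hasDerivWithinAt_gradSqAt_scalAt_ricciFlow hfl hx ht
  have hSt := hG.hasDerivWithinAt_scalAt_ricciFlow hfl hx ht
  have hut : HasDerivWithinAt (fun s ↦ gradSqAt (G s) (scalAt (G s)) x / scalAt (G s) x)
      (((lapAt (G t) (gradSqAt (G t) (scalAt (G t))) x
          - 2 * normSqAt (G t) x (hessAt (G t) (scalAt (G t)) x) + 4 * A) * Sx
        - Vx * (lapAt (G t) (scalAt (G t)) x + 2 * Rn)) / Sx ^ 2) S t := hVt.div hSt hSne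
  have hu_le : ((lapAt (G t) (gradSqAt (G t) (scalAt (G t))) x
          - 2 * normSqAt (G t) x (hessAt (G t) (scalAt (G t)) x) + 4 * A) * Sx
        - Vx * (lapAt (G t) (scalAt (G t)) x + 2 * Rn)) / Sx ^ 2 ≤
      lapAt (G t) (fun y ↦ gradSqAt (G t) (scalAt (G t)) y / scalAt (G t) y) x
        + 4 * A / Sx - 2 * Vx * Rn / Sx ^ 2 := by
    have h := hG.derivWithin_gradSqAt_div_scalAt_le hfl hx ht hpos hS
    rwa [hut.derivWithin hU] at h
  have hRic := hG.hasDerivWithinAt_normSqAt_ricAt_ricciFlow b hfl hx ht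
  have hSq := hG.hasDerivWithinAt_scalAt_sq_div_four_ricciFlow hfl hx ht
  have hEt := hRic.sub hSq
  have hFt : HasDerivWithinAt (fun s ↦ gradSqAt (G s) (scalAt (G s)) x / scalAt (G s) x
        + N * (normSqAt (G s) x (ricAt (G s) x) - scalAt (G s) x ^ 2 / 4))
      (((lapAt (G t) (gradSqAt (G t) (scalAt (G t))) x
          - 2 * normSqAt (G t) x (hessAt (G t) (scalAt (G t)) x) + 4 * A) * Sx
        - Vx * (lapAt (G t) (scalAt (G t)) x + 2 * Rn)) / Sx ^ 2
        + N * ((lapAt (G t) (fun y ↦ normSqAt (G t) y (ricAt (G t) y)) x - 2 * CovR + 4 * BR)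
          - (lapAt (G t) (fun y ↦ scalAt (G t) y ^ 2 / 4) x - Vx / 2 + Sx * Rn))) S t :=
    hut.add (hEt.const_mul N)
  rw [hFt.derivWithin hU]
  -- (2) the Laplacian of `F` splits
  have hlapF : lapAt (G t) (fun y ↦ gradSqAt (G t) (scalAt (G t)) y / scalAt (G t) y
        + N * (normSqAt (G t) y (ricAt (G t) y) - scalAt (G t) y ^ 2 / 4)) x =
      lapAt (G t) (fun y ↦ gradSqAt (G t) (scalAt (G t)) y / scalAt (G t) y) x
        + N * (lapAt (G t) (fun y ↦ normSqAt (G t) y (ricAt (G t) y)) x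
          - lapAt (G t) (fun y ↦ scalAt (G t) y ^ 2 / 4) x) := by
    rw [lapAt_add (G t) hu2 (hE2.const_smul N |>.congr_of_eventuallyEq ?_), lapAt_const_mul (G t) hE2,
      lapAt_sub (G t) hR2 hS2q]
    exact Filter.Eventually.of_forall fun y ↦ by simp [smul_eq_mul]
  rw [hlapF]
  -- (3) the reaction term in traceless form
  have hreact : 4 * BR - Sx * Rn = 4 * BE + Sx * (Rn - Sx ^ 2 / 4) := by
    have h := hGt.reaction_traceless_decomposition b hx h4
    rw [← hEn]
    exact h
  -- (4) the curvature pairing bound `|B(E,E)| ≤ 16 √|Rm|² |E|²`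
  have hBE : 4 * N * BE ≤ N * (64 * Real.sqrt (rmNormSqAt (G t) x)) * (Rn - Sx ^ 2 / 4) := by
    have h := hGt.abs_curvPair_le b hx hpos hEsym
    rw [hn4, hEn] at h
    have h' : BE ≤ 16 * Real.sqrt (rmNormSqAt (G t) x) * (Rn - Sx ^ 2 / 4) := by
      have := (le_abs_self BE).trans h
      norm_num at this
      linarith only [this]
    have h'' := mul_le_mul_of_nonneg_left h' (le_of_lt (mul_pos (by norm_num : (0:ℝ) < 4) hNpos))
    linarith only [h'']
  -- (5) the cross term `A = 2⟨∇_w Ric, E⟩ + (S/2)|∇S|²`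
  have hRd : DifferentiableAt ℝ (ricAt (G t)) x := hGt.differentiableAt_ricAt hx
  have hAeq : A = 2 * pairAt (G t) x (cov₂At (G t) (ricAt (G t)) x w) Ef + Sx / 2 * Vx := by
    have hfun : (fun y ↦ normSqAt (G t) y (ricAt (G t) y)) =ᶠ[𝓝 x]
        fun y ↦ pairAt (G t) y (ricAt (G t) y) (ricAt (G t) y) := by
      filter_upwards [hV.mem_nhds hx] with y hy
      exact (pairAt_self_of_symm (G t) y (hRsym y hy)).symm
    rw [hA, hfun.fderiv_eq, hGt.fderiv_pairAt hx hRd hRd w,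
      pairAt_comm (G t) x (ricAt (G t) x) (cov₂At (G t) (ricAt (G t)) x w)]
    -- `Ric = E + (S/4) G`
    have hdec : ricAt (G t) x = Ef + (Sx / 4) • G t x := by rw [hEf]; abel
    have hmtr : pairAt (G t) x (cov₂At (G t) (ricAt (G t)) x w) (G t x) = Vx := by
      rw [pairAt_metric_right hi, ← hGt.fderiv_scalAt_eq_mtrAt hx w, hw, hφ, hVx, gradSqAt_apply]
    conv_lhs => rw [hdec]
    rw [pairAt_add_right, pairAt_smul_right, hmtr]
    ring
  -- Cauchy–Schwarz for the cross term: `|⟨∇_w Ric, E⟩| ≤ √(CovR·V) √|E|²`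
  have hcovsym : ∀ v v', cov₂At (G t) (ricAt (G t)) x w v v' = cov₂At (G t) (ricAt (G t)) x w v' v :=
    fun v v' ↦ hGt.cov₂At_ricAt_symm hx w v v'
  have hCovR0 : 0 ≤ CovR := hGt.covNormSq_nonneg b hx hpos hGt.contDiffOn_ricAt hRsym
  have hVx0 : 0 ≤ Vx := by
    rw [hVx, gradSqAt_apply, ← hφ, ← apply_sharpAt_apply hi φ (sharpAt (G t) x φ)]
    by_cases h0 : sharpAt (G t) x φ = 0
    · rw [h0]; simp
    · exact (hpos _ h0).le
  have hnablaw : normSqAt (G t) x (cov₂At (G t) (ricAt (G t)) x w) ≤ CovR * Vx := by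
    have h := hGt.normSqAt_cov₂At_sharpAt_le b hx hpos hGt.contDiffOn_ricAt hRsym φ
    rw [← hw] at h
    have hφV : φ (sharpAt (G t) x φ) = Vx := by rw [hVx, gradSqAt_apply, hφ]
    rwa [hφV] at h
  set P : ℝ := pairAt (G t) x (cov₂At (G t) (ricAt (G t)) x w) Ef with hP
  have hPsq : P ^ 2 ≤ (CovR * Vx) * (Rn - Sx ^ 2 / 4) := by
    have h := hGt.pairAt_sq_le hx hpos hcovsym hEsym
    rw [hEn] at h
    exact h.trans (mul_le_mul_of_nonneg_right hnablaw hEn0)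
  -- Young: `8 P / S ≤ (N/10)·CovR + (160Λ/N)·V`
  have h8P : 8 * P / Sx ≤ N / 10 * CovR + 160 * Λ / N * Vx := by
    -- `P² ≤ CovR·V·Λ·S²`, so `(P/S)² ≤ CovR · (Λ V)`
    have hPS : (P / Sx) ^ 2 ≤ CovR * (Λ * Vx) := by
      rw [div_pow, div_le_iff₀ (by positivity)]
      calc P ^ 2 ≤ (CovR * Vx) * (Rn - Sx ^ 2 / 4) := hPsq
        _ ≤ (CovR * Vx) * (Λ * Sx ^ 2) := mul_le_mul_of_nonneg_left hΛ (mul_nonneg hCovR0 hVx0)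
        _ = CovR * (Λ * Vx) * Sx ^ 2 := by ring
    -- AM–GM in the form `8 q ≤ a c + (16/a) d` whenever `q² ≤ c d`, `a > 0`, `c, d ≥ 0`
    have ha : 0 < N / 10 := by positivity
    have hd0 : 0 ≤ Λ * Vx := mul_nonneg hΛ0 hVx0
    have hX0 : 0 ≤ N / 10 * CovR + 16 / (N / 10) * (Λ * Vx) := by positivity
    have hid : (N / 10 * CovR + 16 / (N / 10) * (Λ * Vx)) ^ 2 - 64 * (CovR * (Λ * Vx)) =
        (N / 10 * CovR - 16 / (N / 10) * (Λ * Vx)) ^ 2 := by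
      field_simp
      ring
    have hsq : (8 * (P / Sx)) ^ 2 ≤ (N / 10 * CovR + 16 / (N / 10) * (Λ * Vx)) ^ 2 := by
      nlinarith only [hid, sq_nonneg (N / 10 * CovR - 16 / (N / 10) * (Λ * Vx)), hPS]
    have hkey : 8 * (P / Sx) ≤ N / 10 * CovR + 16 / (N / 10) * (Λ * Vx) :=
      (abs_le_of_sq_le_sq' hsq hX0).2
    have h16 : 16 / (N / 10) * (Λ * Vx) = 160 * Λ / N * Vx := by
      field_simp
      ring
    have h8 : 8 * P / Sx = 8 * (P / Sx) := by ring
    linarith only [hkey, h16, h8]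
  -- (6) Huisken's Lemma 4.3 in dimension 4: `(5/18)|∇S|² ≤ |∇Ric|²`
  have hHuisken : 5 / 18 * Vx ≤ CovR := by
    have h := hGt.mul_gradSqAt_scalAt_le_covNormSq_ricAt b hx hpos
    rw [hn4] at h
    norm_num at h
    exact h
  -- (7) the coefficient of `|∇S|²`
  have hcoef : 3 + 160 * Λ / N - N / 36 ≤ -1 := by
    have h1 : 160 * Λ / N ≤ 1 := by
      rw [div_le_one hNpos, hN]; linarith
    have h2 : N / 36 = 5 * (1 + Λ) := by rw [hN]; ring
    linarith only [h1, h2, hΛ0]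
  have hcoefV : (3 + 160 * Λ / N - N / 36) * Vx ≤ -1 * Vx :=
    mul_le_mul_of_nonneg_right hcoef hVx0
  -- (8) assemble (drop `−2 V |Ric|²/S² ≤ 0`)
  have hdrop : 0 ≤ 2 * Vx * Rn / Sx ^ 2 := by positivity
  have hCovcoef : (N / 10 - 2 * N) * CovR ≤ (N / 10 - 2 * N) * (5 / 18 * Vx) :=
    mul_le_mul_of_nonpos_left hHuisken (by linarith only [hNpos])
  -- rewrite `4A/S` through `P`
  have hA' : 4 * A / Sx = 8 * P / Sx + 2 * Vx := by
    rw [hAeq, hP]; field_simp; ring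
  have hreactN : N * (4 * BR) - N * (Sx * Rn) = N * (4 * BE) + N * (Sx * (Rn - Sx ^ 2 / 4)) := by
    linear_combination N * hreact
  linarith only [hu_le, hreactN, hBE, h8P, hcoefV, hdrop, hCovcoef, hA', hVx0]

end RicciFlow

end IsMetricFamilyOn

end MetricCoord

end Literature.Geometry.Lorentzian

end
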